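import Summits.Ventures.PercRepro.SixFourResidueTwoClauses

/-!
# PercRepro — C-025 at `(6,4)`: the type-`3` clause split into the `g ≤ 9` clause and Theorem 21′ (p3, gen 11)

`TypeThreeClause` (`SixFourResidueClauses.lean`) — the type-`3` half of `SixFourResidue` — asks for `0 ≤ J₃(G)` on
every solid `G` of a simple core matroid with `typeOf M G = 3` and `¬ Cell10 M G`.  Mine-2's §21.17 / §21.18.1
prove it in two pieces that never use `typeOf` or `Cell10`, split at `|G| = 10`:
* `TypeThreeSmall` — `0 ≤ J₃(G)` for every rank-`4` set `G ⊆ E` of a simple matroid with at most `9` points (the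
  statement shape of p2's `J_three_nonneg_of_card_le_nine`, the §21.18.1 trichotomy at `t = 3`);
* `TwentyOnePrime` — **Theorem 21′** (§21.17): `0 ≤ J₃(G)` for every rank-`4` set `G ⊆ E` of a simple matroid
  with at least `10` points — the `t = 3` twin of `TwentyTwoPrime`, stated for EVERY such solid (the cell `Cell10`
  needs no exclusion: it has `J₃ ≥ 768/5`, `J_three_pos_of_cell10`);
and proves **`typeThreeClause_of : TypeThreeSmall → TwentyOnePrime → TypeThreeClause`** (the `g ≤ 9` / `g ≥ 10`
case split, as `sixFourResidue_of_clauses`).  With `smallClause_holds` (`SixFourResidueTwoClauses.lean`) the residue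
now reads **`sixFourResidue_of_three_clauses : TypeThreeSmall → TwentyOnePrime → BigPlaneClause → SixFourResidue`**
and C-025 at `(6,4)` on every finite matroid is **`rls_six_four_of_three_clauses`**; the two named open `Prop`s
are `TwentyOnePrime` (`t = 3`, `g ≥ 10`) and `BigPlaneClause` (`= TwentyTwoPrime`, `t = 4`, a plane trace `≥ 8`).
-/

namespace PercRepro.SixFour

open Finset ThmH PerFlat ThmN

/-- **The `g ≤ 9` clause at `t = 3`**: `0 ≤ J₃(G)` for every rank-`4` set `G ⊆ E` of a simple matroid with at
most `9` points (the shape of p2's `J_three_nonneg_of_card_le_nine`). -/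
def TypeThreeSmall : Prop :=
  ∀ {β : Type} [DecidableEq β] (M : Matroid β) [M.Finite] (G : Finset β), Simple M → G ⊆ gr M →
    M.eRk (G : Set β) = 4 → G.card ≤ 9 → 0 ≤ J M G 3

/-- **Theorem 21′ (§21.17) as a `Prop`**: `0 ≤ J₃(G)` for every rank-`4` set `G ⊆ E` of a simple matroid with at
least `10` points (the `t = 3` twin of `TwentyTwoPrime`; no `typeOf`, no `Cell10`). -/
def TwentyOnePrime : Prop :=
  ∀ {β : Type} [DecidableEq β] (M : Matroid β) [M.Finite] (G : Finset β), Simple M → G ⊆ gr M →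
    M.eRk (G : Set β) = 4 → 10 ≤ G.card → 0 ≤ J M G 3

/-- **The type-`3` clause from its two pieces**: the `g ≤ 9` clause and Theorem 21′ give `TypeThreeClause`
(the hypotheses `typeOf M G = 3` and `¬ Cell10 M G` are not used). -/
theorem typeThreeClause_of (h3s : TypeThreeSmall) (h3b : TwentyOnePrime) : TypeThreeClause := by
  intro β _ M _ G hs _ _ hG _ _
  have hGg : G ⊆ gr M := (mem_flatsQ.1 hG).1
  have hr : M.eRk (G : Set β) = 4 := (mem_flatsQ.1 hG).2.2
  by_cases hg : 10 ≤ G.card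
  · exact h3b M G hs hGg hr hg
  · exact h3s M G hs hGg hr (by omega)

/-- **`SixFourResidue` from the three remaining clauses** (`SmallClause` is discharged by `smallClause_holds`). -/
theorem sixFourResidue_of_three_clauses (h3s : TypeThreeSmall) (h3b : TwentyOnePrime) (h4b : BigPlaneClause) :
    SixFourResidue :=
  sixFourResidue_of_two_clauses (typeThreeClause_of h3s h3b) h4b

/-- **C-025 at `(6, 4)` on every finite matroid from the three remaining clauses**: `RLS M 6 4`. -/
theorem rls_six_four_of_three_clauses {α : Type} (h3s : TypeThreeSmall) (h3b : TwentyOnePrime)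
    (h4b : BigPlaneClause) (M : Matroid α) [M.Finite] : RLS M 6 4 :=
  rls_six_four_of_residue (sixFourResidue_of_three_clauses h3s h3b h4b) M

/-- **C-025 at `(6, 4)` from the two NAMED OPEN `Prop`s of record**, `TwentyOnePrime` (`t = 3`) and
`TwentyTwoPrime` (`t = 4`), given the `g ≤ 9` clause at `t = 3`. -/
theorem rls_six_four_of_primes {α : Type} (h3s : TypeThreeSmall) (h3b : TwentyOnePrime) (h4 : TwentyTwoPrime)
    (M : Matroid α) [M.Finite] : RLS M 6 4 :=
  rls_six_four_of_three_clauses h3s h3b (twentyTwoPrime_iff_bigPlane.1 h4) M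

end PercRepro.SixFour
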